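import Literature.NumberTheory.Automorphic.MirabolicTower
import Literature.NumberTheory.Automorphic.UnipotentColumnRangeHaar
import Literature.NumberTheory.Automorphic.UnipotentColumnSplit
import Literature.NumberTheory.Automorphic.ColumnGroupFourier
import Literature.MeasureTheory.Group.CoveringWeights
import HarnessLib

/-!
# Averaging a covering weight over a column group: the fibre functionals of the mirabolic tower

Topic `NumberTheory/Automorphic`; namespace `Literature.NumberTheory.Automorphic`. This file supplies
the measure-theoretic identity behind each step of the real-point Rankin–Selberg unfolding on `GL_n`
(Jacquet–Shalika (1981), §4; Cogdell (2004), §2.3) in the language of covering weights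
(`Literature.MeasureTheory.Group.CoveringWeights`). Fix a depth `1 ≤ d < n` and write (rational points
diagonally embedded in `G = GL_n(𝔸_K)`, `ratPoints`)

* `Γ_d = Q_d(K)` (`tailUnipotent d`), `P = P_{d+1}(K) = (Q_d ⊓ GL_{d+1})(K)`, `L = GL_d(K)`,
* `U = U_{[d+1,n-1]}(𝔸_K)`, `Y = Y_d(𝔸_K) = U_{[d,d]}(𝔸_K)`, `Q = U_{[d,n-1]}(𝔸_K) = Y U`, with their Haar
  measures `Measure.haar` and Tate boxes.

For a `Γ_d`-covering weight `β` (`Σ_{γ ∈ Γ_d} β(γ x) = 1`) we compute the fibre functional of `P ⋉ U`: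

* `semidirectCoveringLIntegral_eq_of_tail` — `Σ_{p ∈ P} ∫_U β(p u x) du = μ_U(box_U)` (unfold `U(𝔸)`
  over `U(K)` and use the bijection `P × U(K) → Γ_d`, `tailCornerEquiv`);
* `semidirectCoveringLIntegral_boxAverage_eq` — the same value for the **`Y`-average**
  `β'(x) = μ_Y(box_Y)⁻¹ ∫_{box_Y} β(y⁻¹ x) dy` (bijections `L × Y(K) → P`, `L × Q(K) → Γ_d`, inversion and
  rational-conjugation invariance of `μ_Y`, independence of the fundamental domain, the split
  `∫_Q = c ∫_U ∫_Y` of `UnipotentColumnSplit` and `μ_Q(box_Q) = c μ_U(box_U) μ_Y(box_Y)`);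

whence, by `lintegral_mul_eq_of_semidirectCoveringLIntegral_eq`, the **averaging identity**
`lintegral_mul_boxAverage_eq`: `∫ F β' dν = ∫ F β dν` for every measurable `F ≥ 0` on `G` invariant
under `P` and under `U` (♠). Everything is proved.

## References

* H. Jacquet, J. A. Shalika, *On Euler products and the classification of automorphic
  representations I*, Amer. J. Math. 103 (1981), §4 [JacquetShalikaAJM1981].
* J. W. Cogdell, *Analytic theory of L-functions for GL_n*, in *An Introduction to the Langlands
  Program* (2004), §2.3 [CogdellAnalyticTheory2004].
-/

noncomputable section

open MeasureTheory Measure NumberField IsDedekindDomain Matrix Set Filter Topology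
open scoped MatrixGroups ENNReal NNReal
open Literature.MeasureTheory.Group

namespace Literature.NumberTheory.Automorphic

/-! ### Embedded rational points -/

section RatPoints

variable {n : ℕ} {K : Type} [Field K] [NumberField K]

/-- The diagonal embedding `GL_n(K) → GL_n(𝔸_K)` is injective. [folklore] -/
theorem generalLinearGroup_map_algebraMap_injective :
    Function.Injective (Matrix.GeneralLinearGroup.map (algebraMap K (AdeleRing (𝓞 K) K)) :
      GL (Fin n) K → GL (Fin n) (AdeleRing (𝓞 K) K)) := by
  intro g h hgh
  refine Units.ext (Matrix.ext fun i j => ?_)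
  have := congrArg (fun u : GL (Fin n) (AdeleRing (𝓞 K) K) => (u : Matrix (Fin n) (Fin n) (AdeleRing (𝓞 K) K)) i j) hgh
  exact NumberField.AdeleRing.algebraMap_injective (𝓞 K) K this

/-- **The embedded rational points** of a subgroup `H ≤ GL_n(K)`: its image in `GL_n(𝔸_K)`. [folklore] -/
def ratPoints (H : Subgroup (GL (Fin n) K)) : Subgroup (GL (Fin n) (AdeleRing (𝓞 K) K)) :=
  H.map (Matrix.GeneralLinearGroup.map (algebraMap K (AdeleRing (𝓞 K) K)))

/-- Membership in `ratPoints H`. [folklore] -/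
theorem mem_ratPoints_iff (H : Subgroup (GL (Fin n) K)) (g : GL (Fin n) (AdeleRing (𝓞 K) K)) :
    g ∈ ratPoints H ↔ ∃ h ∈ H, Matrix.GeneralLinearGroup.map (algebraMap K (AdeleRing (𝓞 K) K)) h = g :=
  Subgroup.mem_map

/-- `ratPoints` is monotone. [folklore] -/
theorem ratPoints_mono {H H' : Subgroup (GL (Fin n) K)} (h : H ≤ H') : ratPoints H ≤ ratPoints H' :=
  Subgroup.map_mono h

/-- **`H ≃ ratPoints H`** (the embedding is injective). [folklore] -/
def ratPointsEquiv (H : Subgroup (GL (Fin n) K)) : ↥H ≃* ↥(ratPoints H) :=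
  H.equivMapOfInjective _ generalLinearGroup_map_algebraMap_injective

/-- The underlying element of `ratPointsEquiv H h` is the embedded matrix. [folklore] -/
@[simp]
theorem coe_ratPointsEquiv (H : Subgroup (GL (Fin n) K)) (h : ↥H) :
    ((ratPointsEquiv H h : ↥(ratPoints H)) : GL (Fin n) (AdeleRing (𝓞 K) K)) =
      Matrix.GeneralLinearGroup.map (algebraMap K (AdeleRing (𝓞 K) K)) h := rfl

/-- `ratPoints H` is countable. [folklore] -/
instance countable_ratPoints (H : Subgroup (GL (Fin n) K)) : Countable ↥(ratPoints H) := by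
  haveI : Countable (GL (Fin n) K) := countable_generalLinearGroup_numberField n K
  exact Countable.of_equiv _ (ratPointsEquiv H).toEquiv

/-- Membership in `U_{[a,b]}` descends along an injective ring map. [folklore] -/
theorem mem_unipotentColRange_of_map_mem {R S : Type*} [CommRing R] [CommRing S] {f : R →+* S}
    (hf : Function.Injective f) {a b : ℕ} {u : GL (Fin n) R}
    (h : Matrix.GeneralLinearGroup.map f u ∈ unipotentColRange n S a b) : u ∈ unipotentColRange n R a b := by
  have hent : ∀ i j, f ((u : Matrix (Fin n) (Fin n) R) i j) =
      ((Matrix.GeneralLinearGroup.map f u : GL (Fin n) S) : Matrix (Fin n) (Fin n) S) i j := fun _ _ => rfl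
  obtain ⟨hut, hud⟩ := (mem_upperUnitriangular_iff _).1 h.1
  refine ⟨(mem_upperUnitriangular_iff u).2 ⟨fun i j hij => ?_, fun i => ?_⟩, fun i j hij hj => ?_⟩
  · apply hf; rw [hent, map_zero]; exact hut hij
  · apply hf; rw [hent, map_one]; exact hud i
  · apply hf; rw [hent, map_zero]; exact h.2 i j hij hj

/-- **`U_{[a,b]}(K) ≃ Y(K)`-lattice**: the rational column-range group over `K` is in bijection with
the lattice `rationalColRange` inside `U_{[a,b]}(𝔸_K)`. [folklore] -/
def rationalColRangeEquiv (a b : ℕ) : ↥(unipotentColRange n K a b) ≃ ↥(rationalColRange n K a b) :=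
  Equiv.ofBijective
    (fun u => ⟨⟨Matrix.GeneralLinearGroup.map (algebraMap K (AdeleRing (𝓞 K) K)) u,
      map_mem_unipotentColRange _ u.2⟩, (mem_rationalColRange_iff _).2 ⟨(u : GL (Fin n) K), rfl⟩⟩)
    (by
      constructor
      · intro u v huv
        have h := congrArg (fun w : ↥(rationalColRange n K a b) =>
          ((w : ↥(adelicColRange n K a b)) : GL (Fin n) (AdeleRing (𝓞 K) K))) huv
        exact Subtype.ext (generalLinearGroup_map_algebraMap_injective h)
      · rintro ⟨w, hw⟩
        obtain ⟨u₀, hu₀⟩ := (mem_rationalColRange_iff w).1 hw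
        have hu₀mem : u₀ ∈ unipotentColRange n K a b := by
          refine mem_unipotentColRange_of_map_mem (NumberField.AdeleRing.algebraMap_injective (𝓞 K) K) ?_
          rw [hu₀]; exact w.2
        exact ⟨⟨u₀, hu₀mem⟩, Subtype.ext (Subtype.ext hu₀)⟩)

/-- The underlying matrix of `rationalColRangeEquiv a b u` is the embedded matrix. [folklore] -/
@[simp]
theorem coe_rationalColRangeEquiv (a b : ℕ) (u : ↥(unipotentColRange n K a b)) :
    (((rationalColRangeEquiv (n := n) (K := K) a b u : ↥(rationalColRange n K a b)) :
      ↥(adelicColRange n K a b)) : GL (Fin n) (AdeleRing (𝓞 K) K)) =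
      Matrix.GeneralLinearGroup.map (algebraMap K (AdeleRing (𝓞 K) K)) u := rfl

/-- `Q_e ⊓ GL_n = Q_e` as an equivalence of subtypes (the corner condition at `n` is vacuous).
[folklore] -/
def tailInfTopEquiv (e : ℕ) : ↥(tailUnipotent n K e ⊓ cornerGL n K n) ≃ ↥(tailUnipotent n K e) where
  toFun p := ⟨p, (Subgroup.mem_inf.1 p.2).1⟩
  invFun q := ⟨q, Subgroup.mem_inf.2 ⟨q.2, mem_cornerGL_of_le le_rfl _⟩⟩
  left_inv _ := Subtype.ext rfl
  right_inv _ := Subtype.ext rfl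

/-- **Reindexing a sum over `Q_e(K) ⊓ GL_{c'}(K)` as a double sum over `(Q_e ⊓ GL_c)(K) × U_{[c,c'-1]}(K)`**,
for the embedded points acting on `GL_n(𝔸_K)`: `Σ_{q} f(q) = Σ_{k} Σ_{u} f(k u)` (`tailCornerEquiv`).
[folklore] -/
theorem tsum_ratPoints_tail_inf_corner_eq {e c c' : ℕ} (hec : e ≤ c) (hcc' : c ≤ c') (hc' : 0 < c')
    (f : GL (Fin n) (AdeleRing (𝓞 K) K) → ℝ≥0∞) :
    ∑' q : ↥(ratPoints (tailUnipotent n K e ⊓ cornerGL n K c')), f q =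
      ∑' k : ↥(ratPoints (tailUnipotent n K e ⊓ cornerGL n K c)),
        ∑' u : ↥(rationalColRange n K c (c' - 1)),
          f ((k : GL (Fin n) (AdeleRing (𝓞 K) K)) * ((u : ↥(adelicColRange n K c (c' - 1))) : GL (Fin n) (AdeleRing (𝓞 K) K))) := by
  -- the composite equivalence
  set E : ↥(ratPoints (tailUnipotent n K e ⊓ cornerGL n K c)) × ↥(rationalColRange n K c (c' - 1)) ≃
      ↥(ratPoints (tailUnipotent n K e ⊓ cornerGL n K c')) :=
    ((ratPointsEquiv _).toEquiv.symm.prodCongr (rationalColRangeEquiv c (c' - 1)).symm).trans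
      ((tailCornerEquiv (n := n) (R := K) e c c' hec hcc' hc').symm.trans (ratPointsEquiv _).toEquiv) with hE
  have hEcoe : ∀ p : ↥(ratPoints (tailUnipotent n K e ⊓ cornerGL n K c)) × ↥(rationalColRange n K c (c' - 1)),
      ((E p : ↥(ratPoints (tailUnipotent n K e ⊓ cornerGL n K c'))) : GL (Fin n) (AdeleRing (𝓞 K) K)) =
        (p.1 : GL (Fin n) (AdeleRing (𝓞 K) K)) * ((p.2 : ↥(adelicColRange n K c (c' - 1))) : GL (Fin n) (AdeleRing (𝓞 K) K)) := by
    rintro ⟨k, u⟩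
    rw [hE]
    simp only [Equiv.trans_apply, Equiv.prodCongr_apply, Prod.map_apply, MulEquiv.toEquiv_eq_coe,
      MulEquiv.coe_toEquiv, coe_ratPointsEquiv, tailCornerEquiv_symm_apply, map_mul]
    congr 1
    · -- `map ((ratPointsEquiv _).symm k) = k`
      have h := coe_ratPointsEquiv (tailUnipotent n K e ⊓ cornerGL n K c) ((ratPointsEquiv _).symm k)
      rw [MulEquiv.apply_symm_apply] at h
      exact h.symm
    · have h := coe_rationalColRangeEquiv (n := n) (K := K) c (c' - 1) ((rationalColRangeEquiv c (c' - 1)).symm u)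
      rw [Equiv.apply_symm_apply] at h
      exact h.symm
  rw [← E.tsum_eq, ENNReal.tsum_prod']
  refine tsum_congr fun k => tsum_congr fun u => ?_
  rw [hEcoe]

/-- The same with the corner condition at `n` removed on the left: `Σ_{q ∈ Q_e(K)} = Σ_k Σ_u`.
[folklore] -/
theorem tsum_ratPoints_tail_eq {e c : ℕ} (hec : e ≤ c) (hcn : c ≤ n) (hn : 0 < n)
    (f : GL (Fin n) (AdeleRing (𝓞 K) K) → ℝ≥0∞) :
    ∑' q : ↥(ratPoints (tailUnipotent n K e)), f q =
      ∑' k : ↥(ratPoints (tailUnipotent n K e ⊓ cornerGL n K c)),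
        ∑' u : ↥(rationalColRange n K c (n - 1)),
          f ((k : GL (Fin n) (AdeleRing (𝓞 K) K)) * ((u : ↥(adelicColRange n K c (n - 1))) : GL (Fin n) (AdeleRing (𝓞 K) K))) := by
  rw [← tsum_ratPoints_tail_inf_corner_eq hec hcn hn f]
  -- `ratPoints (Q_e ⊓ GL_n) ≃ ratPoints Q_e`
  set E : ↥(ratPoints (tailUnipotent n K e ⊓ cornerGL n K n)) ≃ ↥(ratPoints (tailUnipotent n K e)) :=
    ((ratPointsEquiv _).toEquiv.symm.trans (tailInfTopEquiv (n := n) (K := K) e)).trans (ratPointsEquiv _).toEquiv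
    with hE
  rw [← E.tsum_eq]
  refine tsum_congr fun q => ?_
  congr 1
  rw [hE]
  simp only [Equiv.trans_apply, MulEquiv.toEquiv_eq_coe, MulEquiv.coe_toEquiv, coe_ratPointsEquiv]
  have h := coe_ratPointsEquiv (tailUnipotent n K e ⊓ cornerGL n K n) ((ratPointsEquiv _).symm q)
  rw [MulEquiv.apply_symm_apply] at h
  rw [h]
  rfl

end RatPoints

/-! ### The fibre functional of a `Q_d(K)`-covering weight -/

section Fibre

variable {n : ℕ} {K : Type} [Field K] [NumberField K]
variable [MeasurableSpace (GL (Fin n) (AdeleRing (𝓞 K) K))] [BorelSpace (GL (Fin n) (AdeleRing (𝓞 K) K))]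

/-- **Unfolded covering sums integrate to the box volume.** For `d ≤ c ≤ n`, `0 < n`, a measurable
`β ≥ 0` with `Σ_{γ ∈ Q_d(K)} β(γ x) = 1` for all `x`, and every `x`:
`Σ_{k ∈ (Q_d ⊓ GL_c)(K)} ∫_{U_{[c,n-1]}(𝔸_K)} β(k u x) du = μ(box)` (`μ = Measure.haar`): unfold the
`U(𝔸_K)`-integral over the lattice `U(K)` and its Tate box and reassemble `Σ_k Σ_{υ ∈ U(K)}` into
`Σ_{γ ∈ Q_d(K)} = 1` by the bijection `(Q_d ⊓ GL_c)(K) × U_{[c,n-1]}(K) → Q_d(K)` (`tailCornerEquiv`).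
[folklore] -/
theorem tsum_lintegral_eq_measure_box {d c : ℕ} (hdc : d ≤ c) (hcn : c ≤ n) (hn : 0 < n)
    {β : GL (Fin n) (AdeleRing (𝓞 K) K) → ℝ≥0∞}
    (hβm : Measurable β) (hβ : ∀ x, coveringSum ↥(ratPoints (tailUnipotent n K d)) β x = 1)
    (x : GL (Fin n) (AdeleRing (𝓞 K) K)) :
    ∑' k : ↥(ratPoints (tailUnipotent n K d ⊓ cornerGL n K c)),
        ∫⁻ u : ↥(adelicColRange n K c (n - 1)),
          β ((k : GL (Fin n) (AdeleRing (𝓞 K) K)) * (u : GL (Fin n) (AdeleRing (𝓞 K) K)) * x)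
            ∂(Measure.haar (G := ↥(adelicColRange n K c (n - 1)))) =
      (Measure.haar (G := ↥(adelicColRange n K c (n - 1)))) (colRangeTateDomain n K c (n - 1)) := by
  haveI := secondCountableTopology_generalLinearGroup_adeleRing K (Fin n)
  set U := adelicColRange n K c (n - 1) with hU
  set μU : Measure ↥U := Measure.haar with hμU
  set boxU := colRangeTateDomain n K c (n - 1) with hboxU
  -- unfold each `U(𝔸)`-integral over the lattice
  have hmeas : ∀ g : GL (Fin n) (AdeleRing (𝓞 K) K), Measurable fun u : ↥U => β (g * (u : GL (Fin n) (AdeleRing (𝓞 K) K)) * x) :=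
    fun g => hβm.comp (((continuous_const.mul continuous_subtype_val).mul continuous_const).measurable)
  have step : ∀ γ : ↥(ratPoints (tailUnipotent n K d ⊓ cornerGL n K c)),
      ∫⁻ u : ↥U, β ((γ : GL (Fin n) (AdeleRing (𝓞 K) K)) * (u : GL (Fin n) (AdeleRing (𝓞 K) K)) * x) ∂μU =
        ∫⁻ u in boxU, ∑' υ : ↥(rationalColRange n K c (n - 1)),
          β ((γ : GL (Fin n) (AdeleRing (𝓞 K) K)) * ((υ : ↥U) : GL (Fin n) (AdeleRing (𝓞 K) K)) *
            (u : GL (Fin n) (AdeleRing (𝓞 K) K)) * x) ∂μU := by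
    intro γ
    rw [lintegral_eq_setLIntegral_tsum_colRangeTateDomain μU _ (hmeas γ)]
    refine setLIntegral_congr_fun measurableSet_colRangeTateDomain fun u _ => tsum_congr fun υ => ?_
    rw [Subgroup.smul_def, smul_eq_mul, Subgroup.coe_mul]
    congr 1
    group
  rw [tsum_congr step]
  -- exchange the sum with the box integral
  have hmeas2 : ∀ γ : ↥(ratPoints (tailUnipotent n K d ⊓ cornerGL n K c)),
      Measurable fun u : ↥U => ∑' υ : ↥(rationalColRange n K c (n - 1)),
        β ((γ : GL (Fin n) (AdeleRing (𝓞 K) K)) * ((υ : ↥U) : GL (Fin n) (AdeleRing (𝓞 K) K)) *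
          (u : GL (Fin n) (AdeleRing (𝓞 K) K)) * x) :=
    fun γ => Measurable.tsum fun υ => hmeas _
  rw [← lintegral_tsum fun γ => (hmeas2 γ).aemeasurable]
  -- reassemble the double sum into the covering sum of `Q_d(K)`, which is `1`
  have hsum : ∀ u : ↥U,
      ∑' γ : ↥(ratPoints (tailUnipotent n K d ⊓ cornerGL n K c)),
        ∑' υ : ↥(rationalColRange n K c (n - 1)),
          β ((γ : GL (Fin n) (AdeleRing (𝓞 K) K)) * ((υ : ↥U) : GL (Fin n) (AdeleRing (𝓞 K) K)) *
            (u : GL (Fin n) (AdeleRing (𝓞 K) K)) * x) = 1 := by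
    intro u
    have h := hβ ((u : GL (Fin n) (AdeleRing (𝓞 K) K)) * x)
    rw [coveringSum_apply] at h
    simp only [Subgroup.smul_def, smul_eq_mul] at h
    rw [tsum_ratPoints_tail_eq hdc hcn hn (fun g => β (g * ((u : GL (Fin n) (AdeleRing (𝓞 K) K)) * x)))] at h
    simpa only [mul_assoc] using h
  rw [setLIntegral_congr_fun measurableSet_colRangeTateDomain (fun u _ => hsum u), setLIntegral_one]

/-- **The fibre functional of a `Q_d(K)`-covering weight is the box volume.** For `d + 1 ≤ n`, a
measurable `β ≥ 0` on `GL_n(𝔸_K)` with `Σ_{γ ∈ Q_d(K)} β(γ x) = 1` for all `x`, and every `x`,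
`Σ_{p ∈ P_{d+1}(K)} ∫_{U_{[d+1,n-1]}(𝔸_K)} β(p u x) du = μ_U(box_U)` (`μ_U = Measure.haar`). [folklore] -/
theorem semidirectCoveringLIntegral_eq_of_tail {d : ℕ} (hdn : d + 1 ≤ n) {β : GL (Fin n) (AdeleRing (𝓞 K) K) → ℝ≥0∞}
    (hβm : Measurable β) (hβ : ∀ x, coveringSum ↥(ratPoints (tailUnipotent n K d)) β x = 1)
    (x : GL (Fin n) (AdeleRing (𝓞 K) K)) :
    semidirectCoveringLIntegral (ratPoints (tailUnipotent n K d ⊓ cornerGL n K (d + 1)))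
        (adelicColRange n K (d + 1) (n - 1)) (Measure.haar) β x =
      (Measure.haar (G := ↥(adelicColRange n K (d + 1) (n - 1)))) (colRangeTateDomain n K (d + 1) (n - 1)) := by
  rw [semidirectCoveringLIntegral_apply, ← tsum_lintegral_eq_measure_box (by omega) hdn (by omega) hβm hβ x]
  refine tsum_congr fun γ => lintegral_congr fun u => ?_
  simp only [smul_eq_mul, mul_assoc]

/-! ### The `Y`-average of a weight and its fibre functional -/

omit [MeasurableSpace (GL (Fin n) (AdeleRing (𝓞 K) K))] [BorelSpace (GL (Fin n) (AdeleRing (𝓞 K) K))] in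
/-- **`Y_c(𝔸_K)` is commutative** (`𝔾_a^c`; cf. `colGroup_mul_comm`). [folklore] -/
theorem colGroup_comm {c : ℕ} (hc : c < n) (y y' : ↥(adelicColRange n K c c)) : y * y' = y' * y := by
  obtain ⟨x, rfl⟩ := (colVecHomeomorph (n := n) (K := K) c hc).surjective y
  obtain ⟨x', rfl⟩ := (colVecHomeomorph (n := n) (K := K) c hc).surjective y'
  simp only [colVecHomeomorph_apply]
  rw [← colVecY_add c hc, ← colVecY_add c hc, add_comm]

/-- **The `Y_d`-average of a weight**: `β'(x) = μ_Y(box_Y)⁻¹ ∫_{box_Y} β(y⁻¹ x) dμ_Y(y)`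
(`μ_Y = Measure.haar` on `Y_d(𝔸_K)`). [folklore] -/
def boxAverage (d : ℕ) (β : GL (Fin n) (AdeleRing (𝓞 K) K) → ℝ≥0∞) (x : GL (Fin n) (AdeleRing (𝓞 K) K)) : ℝ≥0∞ :=
  ((Measure.haar (G := ↥(adelicColRange n K d d))) (colRangeTateDomain n K d d))⁻¹ *
    ∫⁻ y in colRangeTateDomain n K d d, β (((y : ↥(adelicColRange n K d d)) : GL (Fin n) (AdeleRing (𝓞 K) K))⁻¹ * x)
      ∂(Measure.haar (G := ↥(adelicColRange n K d d)))

/-- The `Y`-average of a measurable function is measurable. [folklore] -/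
theorem measurable_boxAverage (d : ℕ) {β : GL (Fin n) (AdeleRing (𝓞 K) K) → ℝ≥0∞} (hβ : Measurable β) :
    Measurable (boxAverage (K := K) d β) := by
  haveI := secondCountableTopology_generalLinearGroup_adeleRing K (Fin n)
  unfold boxAverage
  refine Measurable.const_mul ?_ _
  have hm : Measurable (Function.uncurry fun (x : GL (Fin n) (AdeleRing (𝓞 K) K)) (y : ↥(adelicColRange n K d d)) =>
      β (((y : ↥(adelicColRange n K d d)) : GL (Fin n) (AdeleRing (𝓞 K) K))⁻¹ * x)) :=
    hβ.comp (((continuous_subtype_val.comp continuous_snd).inv).mul continuous_fst).measurable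
  exact hm.lintegral_prod_right'

/-- **Unfolding `Y(K) \ Y(𝔸)` after inversion and a rational conjugation.** For a rational `k`
normalising `Y_d(𝔸_K)` (conjugation hypothesis `hθ` for `k⁻¹`) and measurable `f ≥ 0` on `GL_n(𝔸_K)`,
`Σ_{η ∈ Y_d(K)} ∫_{box_Y} f(y⁻¹ k η) dμ_Y(y) = ∫_{Y_d(𝔸_K)} f(k z) dμ_Y(z)`: `y⁻¹ k η = k (k⁻¹ y⁻¹ k) η =
k (η z)` with `z = k⁻¹ y⁻¹ k` (`Y_d` is commutative); `y ↦ z` preserves `μ_Y` (inversion and rational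
conjugation) and maps the box onto another fundamental domain of `Y_d(K)`, so the sum of the
integrals over its `Y_d(K)`-translates is the integral over `Y_d(𝔸_K)`. [folklore] -/
theorem tsum_setLIntegral_box_inv_conj_eq {d : ℕ} (hd : d < n) (k₀ : GL (Fin n) K)
    (hθ : ∀ u : GL (Fin n) (AdeleRing (𝓞 K) K), u ∈ adelicColRange n K d d ↔
      Matrix.GeneralLinearGroup.map (algebraMap K (AdeleRing (𝓞 K) K)) k₀⁻¹ * u *
        (Matrix.GeneralLinearGroup.map (algebraMap K (AdeleRing (𝓞 K) K)) k₀⁻¹)⁻¹ ∈ adelicColRange n K d d)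
    {f : GL (Fin n) (AdeleRing (𝓞 K) K) → ℝ≥0∞} (hf : Measurable f) :
    ∑' η : ↥(rationalColRange n K d d), ∫⁻ y in colRangeTateDomain n K d d,
        f (((y : ↥(adelicColRange n K d d)) : GL (Fin n) (AdeleRing (𝓞 K) K))⁻¹ *
          Matrix.GeneralLinearGroup.map (algebraMap K (AdeleRing (𝓞 K) K)) k₀ *
            ((η : ↥(adelicColRange n K d d)) : GL (Fin n) (AdeleRing (𝓞 K) K)))
        ∂(Measure.haar (G := ↥(adelicColRange n K d d))) =
      ∫⁻ z, f (Matrix.GeneralLinearGroup.map (algebraMap K (AdeleRing (𝓞 K) K)) k₀ *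
          ((z : ↥(adelicColRange n K d d)) : GL (Fin n) (AdeleRing (𝓞 K) K)))
        ∂(Measure.haar (G := ↥(adelicColRange n K d d))) := by
  set Y := adelicColRange n K d d with hY
  set μ : Measure ↥Y := Measure.haar with hμ
  set k := Matrix.GeneralLinearGroup.map (algebraMap K (AdeleRing (𝓞 K) K)) k₀ with hk
  haveI : μ.IsInvInvariant := isInvInvariant_of_isHaarMeasure_adelicColRange μ
  have hkinv : Matrix.GeneralLinearGroup.map (algebraMap K (AdeleRing (𝓞 K) K)) k₀⁻¹ = k⁻¹ := map_inv _ _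
  -- the map `ψ y = k⁻¹ y⁻¹ k`
  set θ := colRangeConj (n := n) (K := K) _ hθ with hθdef
  have hθcoe : ∀ y : ↥Y, ((θ y : ↥Y) : GL (Fin n) (AdeleRing (𝓞 K) K)) = k⁻¹ * y * k := fun y => by
    rw [hθdef, coe_colRangeConj_apply, hkinv, inv_inv]
  have hθmp : MeasurePreserving θ μ μ := measurePreserving_colRangeConj_of_rational hθ μ
  set ψ : ↥Y → ↥Y := fun y => θ y⁻¹ with hψ
  have hψmp : MeasurePreserving ψ μ μ := hθmp.comp (measurePreserving_inv μ)
  have hψemb : MeasurableEmbedding ψ :=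
    (θ.toHomeomorph.toMeasurableEquiv.measurableEmbedding).comp (MeasurableEquiv.inv ↥Y).measurableEmbedding
  -- the integrand as a function on `Y`: `f (y⁻¹ k η) = F (η • ψ y)` with `F z = f (k z)`
  set F : ↥Y → ℝ≥0∞ := fun z => f (k * (z : GL (Fin n) (AdeleRing (𝓞 K) K))) with hF
  have hFm : Measurable F := hf.comp (continuous_const.mul continuous_subtype_val).measurable
  have hpt : ∀ (η : ↥(rationalColRange n K d d)) (y : ↥Y),
      f (((y : ↥Y) : GL (Fin n) (AdeleRing (𝓞 K) K))⁻¹ * k * ((η : ↥Y) : GL (Fin n) (AdeleRing (𝓞 K) K))) =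
        F (η • ψ y) := by
    intro η y
    simp only [hF, hψ, Subgroup.smul_def, smul_eq_mul]
    rw [colGroup_comm hd (η : ↥Y) (θ y⁻¹), Subgroup.coe_mul, hθcoe, Subgroup.coe_inv]
    congr 1
    group
  clear_value ψ F
  rw [tsum_congr fun η => setLIntegral_congr_fun measurableSet_colRangeTateDomain (fun y _ => hpt η y)]
  -- move to the image fundamental domain
  have hstep : ∀ η : ↥(rationalColRange n K d d),
      ∫⁻ y in colRangeTateDomain n K d d, F (η • ψ y) ∂μ = ∫⁻ z in ψ '' colRangeTateDomain n K d d, F (η • z) ∂μ :=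
    fun η => hψmp.setLIntegral_comp_emb hψemb (fun z => F (η • z)) (colRangeTateDomain n K d d)
  rw [tsum_congr hstep]
  -- `ψ '' box` is a fundamental domain of `Y(K)`
  have hbox := isFundamentalDomain_colRangeTateDomain (n := n) (K := K) (a := d) (b := d) μ
  have hinvfd : IsFundamentalDomain ↥(rationalColRange n K d d)
      ((fun y : ↥Y => y⁻¹) '' colRangeTateDomain n K d d) μ := by
    refine hbox.image_of_equiv (MeasurableEquiv.inv ↥Y).toEquiv
      (measurePreserving_inv μ).quasiMeasurePreserving (Equiv.inv ↥(rationalColRange n K d d)) fun γ y => ?_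
    change (γ⁻¹ • y)⁻¹ = γ • y⁻¹
    rw [Subgroup.smul_def, Subgroup.smul_def, smul_eq_mul, smul_eq_mul, _root_.mul_inv_rev, Subgroup.coe_inv,
      inv_inv, colGroup_comm hd y⁻¹ (γ : ↥Y)]
  have hfd : IsFundamentalDomain ↥(rationalColRange n K d d) (ψ '' colRangeTateDomain n K d d) μ := by
    have himg : ψ '' colRangeTateDomain n K d d = θ '' ((fun y : ↥Y => y⁻¹) '' colRangeTateDomain n K d d) := by
      rw [hψ, Set.image_image]
    rw [himg]
    exact Literature.MeasureTheory.Group.isFundamentalDomain_image_continuousMulEquiv μ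
      (rationalColRange n K d d) hinvfd θ (colRangeConj_mem_rationalColRange_iff hθ)
  rw [hfd.lintegral_eq_tsum'' F]

/-- **The fibre functional of the `Y`-average is again the box volume** (♠, fibre form): for
`1 ≤ d < n`, `β` a measurable `Q_d(K)`-covering weight, and every `x`,
`Σ_{p ∈ P_{d+1}(K)} ∫_U β'(p u x) du = μ_U(box_U)` for `β' = boxAverage d β`. Write `p = k η`
(`GL_d(K) × Y_d(K) ≅ P_{d+1}(K)`), unfold `Σ_η ∫_{box_Y}` into `∫_{Y(𝔸)}` after the change of variables
`z = k⁻¹ y⁻¹ k` (`tsum_setLIntegral_box_inv_conj_eq`), combine `∫_U ∫_Y` into `c⁻¹ ∫_Q`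
(`lintegral_adelicColRange_eq_mul_lintegral_prod_swap`), and sum over `k` (`GL_d(K) × Q(K) ≅ Q_d(K)`,
`tsum_lintegral_eq_measure_box`): the result is `μ_Y(box_Y)⁻¹ c⁻¹ μ_Q(box_Q) = μ_U(box_U)`. [folklore] -/
theorem semidirectCoveringLIntegral_boxAverage_eq {d : ℕ} (hd : d < n) (hd0 : 0 < d)
    {β : GL (Fin n) (AdeleRing (𝓞 K) K) → ℝ≥0∞}
    (hβm : Measurable β) (hβ : ∀ x, coveringSum ↥(ratPoints (tailUnipotent n K d)) β x = 1)
    (x : GL (Fin n) (AdeleRing (𝓞 K) K)) :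
    semidirectCoveringLIntegral (ratPoints (tailUnipotent n K d ⊓ cornerGL n K (d + 1)))
        (adelicColRange n K (d + 1) (n - 1)) (Measure.haar) (boxAverage (K := K) d β) x =
      (Measure.haar (G := ↥(adelicColRange n K (d + 1) (n - 1)))) (colRangeTateDomain n K (d + 1) (n - 1)) := by
  haveI := secondCountableTopology_generalLinearGroup_adeleRing K (Fin n)
  set U := adelicColRange n K (d + 1) (n - 1) with hU
  set Y := adelicColRange n K d d with hY
  set Q := adelicColRange n K d (n - 1) with hQ
  set μU : Measure ↥U := Measure.haar with hμU
  set μY : Measure ↥Y := Measure.haar with hμY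
  set μQ : Measure ↥Q := Measure.haar with hμQ
  set VY := μY (colRangeTateDomain n K d d) with hVY
  have hVY0 : VY ≠ 0 := (measure_colRangeTateDomain_pos_of_isHaarMeasure μY).ne'
  have hVYtop : VY ≠ ⊤ := (measure_colRangeTateDomain_lt_top μY).ne
  -- the split `∫_Q = c ∫_U ∫_Y f(z u)` and `μ_Q(box_Q) = c μ_U(box_U) μ_Y(box_Y)`
  obtain ⟨c, hc0, hc, -, hsplit, hvol⟩ :=
    lintegral_adelicColRange_eq_mul_lintegral_prod_swap (n := n) (K := K) (a := d) (b := n - 1) d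
      (by omega) (by omega) μU μY μQ
  -- Step A: unfold the functional and reindex `p = k η`
  rw [semidirectCoveringLIntegral_apply]
  have hA := tsum_ratPoints_tail_inf_corner_eq (n := n) (K := K) (e := d) (c := d) (c' := d + 1) le_rfl
    (by omega) (by omega)
    (fun p => ∫⁻ u : ↥U, boxAverage (K := K) d β (p * ((u : GL (Fin n) (AdeleRing (𝓞 K) K)) * x)) ∂μU)
  simp only [smul_eq_mul] at hA ⊢
  rw [hA]
  -- measurability helpers
  have hmβ2 : Measurable (Function.uncurry fun (g : GL (Fin n) (AdeleRing (𝓞 K) K)) (y : ↥Y) =>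
      β (((y : ↥Y) : GL (Fin n) (AdeleRing (𝓞 K) K))⁻¹ * g)) :=
    hβm.comp (((continuous_subtype_val.comp continuous_snd).inv).mul continuous_fst).measurable
  have hmbox : ∀ g₁ g₂ : GL (Fin n) (AdeleRing (𝓞 K) K), Measurable fun u : ↥U =>
      ∫⁻ y in colRangeTateDomain n K d d, β (((y : ↥Y) : GL (Fin n) (AdeleRing (𝓞 K) K))⁻¹ *
        (g₁ * ((u : GL (Fin n) (AdeleRing (𝓞 K) K)) * g₂))) ∂μY := by
    intro g₁ g₂
    have hcont : Continuous fun u : ↥U => g₁ * ((u : GL (Fin n) (AdeleRing (𝓞 K) K)) * g₂) :=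
      continuous_const.mul (continuous_subtype_val.mul continuous_const)
    exact (hmβ2.lintegral_prod_right').comp hcont.measurable
  -- Step B/C: for fixed `k`, bring `Σ_η` inside `∫_U` and unfold over `Y`
  have hBC : ∀ k : ↥(ratPoints (tailUnipotent n K d ⊓ cornerGL n K d)),
      ∑' η : ↥(rationalColRange n K d (d + 1 - 1)),
        ∫⁻ u : ↥U, boxAverage (K := K) d β ((k : GL (Fin n) (AdeleRing (𝓞 K) K)) *
          ((η : ↥(adelicColRange n K d (d + 1 - 1))) : GL (Fin n) (AdeleRing (𝓞 K) K)) *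
            ((u : GL (Fin n) (AdeleRing (𝓞 K) K)) * x)) ∂μU =
        VY⁻¹ * ∫⁻ u : ↥U, ∫⁻ z : ↥Y, β ((k : GL (Fin n) (AdeleRing (𝓞 K) K)) * (z : GL (Fin n) (AdeleRing (𝓞 K) K)) *
          ((u : GL (Fin n) (AdeleRing (𝓞 K) K)) * x)) ∂μY ∂μU := by
    intro k
    -- `k` is a rational corner element: it normalises `Y_d(𝔸)`
    obtain ⟨k₀, hk₀, hk₀e⟩ := (mem_ratPoints_iff _ _).1 k.2
    have hk₀c : k₀ ∈ cornerGL n K d := (Subgroup.mem_inf.1 hk₀).2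
    have hkinvc : Matrix.GeneralLinearGroup.map (algebraMap K (AdeleRing (𝓞 K) K)) k₀⁻¹ ∈
        cornerGL n (AdeleRing (𝓞 K) K) d := by
      intro i j hij
      change algebraMap K (AdeleRing (𝓞 K) K) (((k₀⁻¹ : GL (Fin n) K) : Matrix (Fin n) (Fin n) K) i j) = _
      rw [((cornerGL n K d).inv_mem hk₀c) i j hij]
      split_ifs <;> simp
    have hθ : ∀ u : GL (Fin n) (AdeleRing (𝓞 K) K), u ∈ adelicColRange n K d d ↔
        Matrix.GeneralLinearGroup.map (algebraMap K (AdeleRing (𝓞 K) K)) k₀⁻¹ * u *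
          (Matrix.GeneralLinearGroup.map (algebraMap K (AdeleRing (𝓞 K) K)) k₀⁻¹)⁻¹ ∈ adelicColRange n K d d := by
      intro u
      constructor
      · intro hu; exact conj_mem_unipotentColRange_of_mem_cornerGL hkinvc hu
      · intro hu
        have h := conj_mem_unipotentColRange_of_mem_cornerGL ((cornerGL n _ d).inv_mem hkinvc) hu
        simpa [mul_assoc] using h
    -- exchange `Σ_η` and `∫_U`
    have hm1 : ∀ η : ↥(rationalColRange n K d (d + 1 - 1)), Measurable fun u : ↥U =>
        boxAverage (K := K) d β ((k : GL (Fin n) (AdeleRing (𝓞 K) K)) *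
          ((η : ↥(adelicColRange n K d (d + 1 - 1))) : GL (Fin n) (AdeleRing (𝓞 K) K)) *
            ((u : GL (Fin n) (AdeleRing (𝓞 K) K)) * x)) := fun η =>
      (measurable_boxAverage d hβm).comp (continuous_const.mul (continuous_subtype_val.mul continuous_const)).measurable
    rw [← lintegral_tsum fun η => (hm1 η).aemeasurable]
    -- pull out the constant and unfold `Σ_η ∫_{box}` into `∫_Y`
    have hinner : ∀ u : ↥U,
        ∑' η : ↥(rationalColRange n K d (d + 1 - 1)),
          boxAverage (K := K) d β ((k : GL (Fin n) (AdeleRing (𝓞 K) K)) *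
            ((η : ↥(adelicColRange n K d (d + 1 - 1))) : GL (Fin n) (AdeleRing (𝓞 K) K)) *
              ((u : GL (Fin n) (AdeleRing (𝓞 K) K)) * x)) =
          VY⁻¹ * ∫⁻ z : ↥Y, β ((k : GL (Fin n) (AdeleRing (𝓞 K) K)) * (z : GL (Fin n) (AdeleRing (𝓞 K) K)) *
            ((u : GL (Fin n) (AdeleRing (𝓞 K) K)) * x)) ∂μY := by
      intro u
      unfold boxAverage
      rw [ENNReal.tsum_mul_left]
      congr 1
      have hB := tsum_setLIntegral_box_inv_conj_eq (n := n) (K := K) hd k₀ hθ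
        (f := fun g => β (g * ((u : GL (Fin n) (AdeleRing (𝓞 K) K)) * x)))
        (hβm.comp (continuous_id.mul continuous_const).measurable)
      rw [hk₀e] at hB
      change ∑' η : ↥(rationalColRange n K d d), ∫⁻ y in colRangeTateDomain n K d d,
        β (((y : ↥Y) : GL (Fin n) (AdeleRing (𝓞 K) K))⁻¹ * ((k : GL (Fin n) (AdeleRing (𝓞 K) K)) *
          ((η : ↥Y) : GL (Fin n) (AdeleRing (𝓞 K) K)) * ((u : GL (Fin n) (AdeleRing (𝓞 K) K)) * x))) ∂μY = _
      simp only [mul_assoc] at hB ⊢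
      exact hB
    rw [lintegral_congr fun u => hinner u]
    have hm2 : Measurable fun u : ↥U => ∫⁻ z : ↥Y,
        β ((k : GL (Fin n) (AdeleRing (𝓞 K) K)) * (z : GL (Fin n) (AdeleRing (𝓞 K) K)) *
          ((u : GL (Fin n) (AdeleRing (𝓞 K) K)) * x)) ∂μY := by
      have hu : Measurable (Function.uncurry fun (u : ↥U) (z : ↥Y) =>
          β ((k : GL (Fin n) (AdeleRing (𝓞 K) K)) * (z : GL (Fin n) (AdeleRing (𝓞 K) K)) *
            ((u : GL (Fin n) (AdeleRing (𝓞 K) K)) * x))) :=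
        hβm.comp (((continuous_const.mul (continuous_subtype_val.comp continuous_snd)).mul
          ((continuous_subtype_val.comp continuous_fst).mul continuous_const))).measurable
      exact hu.lintegral_prod_right'
    exact lintegral_const_mul _ hm2
  rw [tsum_congr hBC, ENNReal.tsum_mul_left]
  -- Step D: `∫_U ∫_Y β(k z u x) = c⁻¹ ∫_Q β(k q x)`
  have hD : ∀ k : ↥(ratPoints (tailUnipotent n K d ⊓ cornerGL n K d)),
      ∫⁻ u : ↥U, ∫⁻ z : ↥Y, β ((k : GL (Fin n) (AdeleRing (𝓞 K) K)) * (z : GL (Fin n) (AdeleRing (𝓞 K) K)) *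
          ((u : GL (Fin n) (AdeleRing (𝓞 K) K)) * x)) ∂μY ∂μU =
        c⁻¹ * ∫⁻ q : ↥Q, β ((k : GL (Fin n) (AdeleRing (𝓞 K) K)) * (q : GL (Fin n) (AdeleRing (𝓞 K) K)) * x) ∂μQ := by
    intro k
    have hf : Measurable fun q : ↥Q => β ((k : GL (Fin n) (AdeleRing (𝓞 K) K)) * (q : GL (Fin n) (AdeleRing (𝓞 K) K)) * x) :=
      hβm.comp ((continuous_const.mul continuous_subtype_val).mul continuous_const).measurable
    have h := hsplit _ hf
    have h' : ∫⁻ u : ↥U, ∫⁻ z : ↥Y, β ((k : GL (Fin n) (AdeleRing (𝓞 K) K)) * (z : GL (Fin n) (AdeleRing (𝓞 K) K)) *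
        ((u : GL (Fin n) (AdeleRing (𝓞 K) K)) * x)) ∂μY ∂μU =
        ∫⁻ u : ↥U, ∫⁻ z : ↥Y, β ((k : GL (Fin n) (AdeleRing (𝓞 K) K)) *
          ((lowMulHigh (n := n) (K := K) d (by omega) (by omega) (u, z) : ↥Q) : GL (Fin n) (AdeleRing (𝓞 K) K)) * x) ∂μY ∂μU := by
      refine lintegral_congr fun u => lintegral_congr fun z => ?_
      rw [coe_lowMulHigh]
      congr 1
      simp only [mul_assoc]
    rw [h', h, ← mul_assoc, ENNReal.inv_mul_cancel hc0 hc, one_mul]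
  rw [tsum_congr hD, ENNReal.tsum_mul_left, tsum_lintegral_eq_measure_box (d := d) (c := d) le_rfl (by omega) (by omega) hβm hβ x,
    hvol]
  -- `VY⁻¹ (c⁻¹ (c (VU VY))) = VU`
  rw [← mul_assoc c⁻¹, ENNReal.inv_mul_cancel hc0 hc, one_mul, mul_comm (μU _) VY, ← mul_assoc,
    ENNReal.inv_mul_cancel hVY0 hVYtop, one_mul]

/-- **The averaging identity (♠).** Let `1 ≤ d < n`, `ν` an s-finite left-invariant measure on
`G = GL_n(𝔸_K)`, `F ≥ 0` measurable on `G`, left-invariant under `P_{d+1}(K)` and under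
`U_{[d+1,n-1]}(𝔸_K)`, and `β` a measurable `Q_d(K)`-covering weight. Then
`∫ F · (boxAverage d β) dν = ∫ F β dν`: both weights have the same constant fibre functional for
`P_{d+1}(K) ⋉ U(𝔸_K)` (`semidirectCoveringLIntegral_eq_of_tail`,
`semidirectCoveringLIntegral_boxAverage_eq`), so `lintegral_mul_eq_of_semidirectCoveringLIntegral_eq`
applies (the `U`-integrals commute with `P_{d+1}(K)` because its elements normalise `U(𝔸_K)` with
measure-preserving conjugation). This is the step "replace `β` by its `Y`-average" of the
Rankin–Selberg unfolding (Jacquet–Shalika (1981), §4). [folklore] -/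
theorem lintegral_mul_boxAverage_eq {d : ℕ} (hd : d < n) (hd0 : 0 < d)
    (ν : Measure (GL (Fin n) (AdeleRing (𝓞 K) K))) [SFinite ν] [ν.IsMulLeftInvariant]
    {F : GL (Fin n) (AdeleRing (𝓞 K) K) → ℝ≥0∞} (hF : Measurable F)
    (hFP : ∀ (p : ↥(ratPoints (tailUnipotent n K d ⊓ cornerGL n K (d + 1)))) (x : GL (Fin n) (AdeleRing (𝓞 K) K)),
      F ((p : GL (Fin n) (AdeleRing (𝓞 K) K)) * x) = F x)
    (hFU : ∀ (u : ↥(adelicColRange n K (d + 1) (n - 1))) (x : GL (Fin n) (AdeleRing (𝓞 K) K)),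
      F ((u : GL (Fin n) (AdeleRing (𝓞 K) K)) * x) = F x)
    {β : GL (Fin n) (AdeleRing (𝓞 K) K) → ℝ≥0∞}
    (hβm : Measurable β) (hβ : ∀ x, coveringSum ↥(ratPoints (tailUnipotent n K d)) β x = 1) :
    ∫⁻ x, F x * boxAverage (K := K) d β x ∂ν = ∫⁻ x, F x * β x ∂ν := by
  haveI := secondCountableTopology_generalLinearGroup_adeleRing K (Fin n)
  set U := adelicColRange n K (d + 1) (n - 1) with hU
  set μU : Measure ↥U := Measure.haar with hμU
  have hV0 : μU (colRangeTateDomain n K (d + 1) (n - 1)) ≠ 0 :=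
    (measure_colRangeTateDomain_pos_of_isHaarMeasure μU).ne'
  have hVtop : μU (colRangeTateDomain n K (d + 1) (n - 1)) ≠ ⊤ := (measure_colRangeTateDomain_lt_top μU).ne
  refine lintegral_mul_eq_of_semidirectCoveringLIntegral_eq
    (ratPoints (tailUnipotent n K d ⊓ cornerGL n K (d + 1))) U μU ν ?_ ?_ hF ?_ ?_
    (measurable_boxAverage d hβm) hβm hV0 hVtop
    (semidirectCoveringLIntegral_boxAverage_eq hd hd0 hβm hβ)
    (semidirectCoveringLIntegral_eq_of_tail (by omega) hβm hβ)
  · -- inversion invariance of `μU`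
    intro f hf
    exact lintegral_inv_eq_of_isHaarMeasure_adelicColRange μU hf
  · -- `U`-integrals commute with `P_{d+1}(K)`: conjugate by the rational normaliser
    intro γ x f hf
    obtain ⟨p₀, hp₀, hp₀e⟩ := (mem_ratPoints_iff _ _).1 γ.2
    have hp₀c : p₀ ∈ cornerGL n K (d + 1) := (Subgroup.mem_inf.1 hp₀).2
    have hpc : Matrix.GeneralLinearGroup.map (algebraMap K (AdeleRing (𝓞 K) K)) p₀ ∈
        cornerGL n (AdeleRing (𝓞 K) K) (d + 1) := by
      intro i j hij
      change algebraMap K (AdeleRing (𝓞 K) K) ((p₀ : Matrix (Fin n) (Fin n) K) i j) = _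
      rw [hp₀c i j hij]
      split_ifs <;> simp
    have hθ : ∀ u : GL (Fin n) (AdeleRing (𝓞 K) K), u ∈ adelicColRange n K (d + 1) (n - 1) ↔
        Matrix.GeneralLinearGroup.map (algebraMap K (AdeleRing (𝓞 K) K)) p₀ * u *
          (Matrix.GeneralLinearGroup.map (algebraMap K (AdeleRing (𝓞 K) K)) p₀)⁻¹ ∈ adelicColRange n K (d + 1) (n - 1) := by
      intro u
      constructor
      · intro hu; exact conj_mem_unipotentColRange_of_mem_cornerGL hpc hu
      · intro hu
        have h := conj_mem_unipotentColRange_of_mem_cornerGL ((cornerGL n _ (d + 1)).inv_mem hpc) hu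
        simpa [mul_assoc] using h
    have hf' : Measurable fun u : ↥U => f ((u : GL (Fin n) (AdeleRing (𝓞 K) K)) • (γ : GL (Fin n) (AdeleRing (𝓞 K) K)) • x) :=
      hf.comp ((continuous_subtype_val.smul continuous_const)).measurable
    rw [← lintegral_colRangeConj_eq_of_rational hθ μU hf']
    refine lintegral_congr fun u => ?_
    simp only [smul_eq_mul, coe_colRangeConj_apply, hp₀e]
    congr 1
    simp only [mul_assoc, inv_mul_cancel_left]
  · intro γ x; exact hFP γ x
  · intro u x; exact hFU u x

end Fibre

end Literature.NumberTheory.Automorphic
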